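import Summits.CriticalPhenomena.PercolationContinuityZ3.Theorems.Transplant.K4MinorFreeDirac
import Summits.CriticalPhenomena.PercolationContinuityZ3.Theorems.Transplant.FKConnectivityAllQTwoTree
import HarnessLib

/-!
# `K₄`-minor-free graphs are partial 2-trees — file 4: the converse (2-trees have no `K₄` minor) and the characterisation

Support file (`--supports stmt-CriticalPhenomena-4575`), FK sub-lane `prim-bschramm-fk-3` (gen 6) of the post-continuity
programme; builds on p205010 (kernel theorem, internal audit signed; external expert review pending).  Pure graph theory; no named
facts, no sorries; standard axioms.

* `K4Free.hasK4Minor_of_stack` — the reverse of `hasK4Minor_of_suppress`: STACKING a vertex `x` onto an edge `uv` (new edges only at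
  `x`, all neighbours of `x` among `u, v`, `u ~ v`) does not create a `K₄` minor (remove `x` from its branch set; it is replaced by
  whichever of `u, v` lies in the same set);
* `K4Free.not_hasK4Minor_of_isTwoTree` — the edge graph of a 2-tree (fk-1's `FK.IsTwoTree`) has no `K₄` minor (induction);
* **`K4Free.not_hasK4Minor_iff_exists_isTwoTree`** — for a finite graph on `≥ 2` vertices: no `K₄` minor ⟺ its edges lie inside a
  2-tree (Dirac 1952 / Duffin 1965 / Wald–Colbourn 1983: '`K₄`-minor-free = partial 2-tree = series–parallel'); the forward direction is
  `exists_superset_of_not_hasK4Minor` of file 3.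
[cite: Diestel2017, §7.3 (Prop. 7.3.1, Cor. 7.3.2); §1.7] [cite: Wagner2006, §5.3]
-/

namespace Summit.CriticalPhenomena.PercolationContinuityZ3.Theorems

namespace K4Free

open Literature.Probability.LatticeModels (HasK4Minor)
open FK (IsTwoTree)

variable {V : Type*}

/-! ### Stacking a vertex onto an edge preserves `K₄`-minor-freeness -/

/-- Two distinct reachable vertices: the first has a neighbour. [folklore] -/
theorem exists_adj_of_reachable_ne {W : Type*} {H : SimpleGraph W} {a b : W} (h : H.Reachable a b) (hab : a ≠ b) :
    ∃ c, H.Adj a c := by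
  obtain ⟨p⟩ := h
  cases p with
  | nil => exact (hab rfl).elim
  | cons h' _ => exact ⟨_, h'⟩

/-- In a `K₄` minor, a branch set containing a vertex `x` all of whose neighbours lie in `{u, v}` also contains `u` or `v`.
[folklore] -/
theorem mem_or_mem_of_hasK4Minor_branch {G' : SimpleGraph V} {x u v : V} (hN : ∀ b, G'.Adj x b → b = u ∨ b = v)
    {B : Fin 4 → Set V} (hconn : ∀ i, (G'.induce (B i)).Connected) (hdisj : ∀ i j, i ≠ j → Disjoint (B i) (B j))
    (hadj : ∀ i j, i ≠ j → ∃ a ∈ B i, ∃ b ∈ B j, G'.Adj a b) {i : Fin 4} (hx : x ∈ B i) : u ∈ B i ∨ v ∈ B i := by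
  classical
  by_contra hnot
  push Not at hnot
  obtain ⟨hu, hv⟩ := hnot
  -- every vertex of `B i` other than `x` would give `x` a neighbour inside `B i`; so `B i = {x}`
  have hBx : ∀ y ∈ B i, y = x := by
    intro y hy
    by_contra hyx
    obtain ⟨z, hz⟩ := exists_adj_of_reachable_ne ((hconn i) ⟨x, hx⟩ ⟨y, hy⟩)
      (fun h => hyx (congrArg Subtype.val h).symm)
    have hz' := SimpleGraph.induce_adj.1 hz
    rcases hN _ hz' with h1 | h1
    · exact hu (h1 ▸ z.2)
    · exact hv (h1 ▸ z.2)
  -- the three other branch sets are each joined to `B i = {x}`, hence contain `u` or `v`: too many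
  have hother : ∀ j, j ≠ i → u ∈ B j ∨ v ∈ B j := by
    intro j hj
    obtain ⟨a, ha, b, hb, hab⟩ := hadj i j hj.symm
    rw [hBx a ha] at hab
    rcases hN b hab with rfl | rfl
    · exact Or.inl hb
    · exact Or.inr hb
  -- pick the three indices different from `i`
  have hcount : ∀ j k : Fin 4, j ≠ i → k ≠ i → j ≠ k → ∀ l : Fin 4, l ≠ i → l ≠ j → l ≠ k → False := by
    intro j k hj hk hjk l hl hlj hlk
    rcases hother j hj with hju | hjv <;> rcases hother k hk with hku | hkv
    · exact Set.disjoint_left.1 (hdisj j k hjk) hju hku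
    · rcases hother l hl with hlu | hlv
      · exact Set.disjoint_left.1 (hdisj j l hlj.symm) hju hlu
      · exact Set.disjoint_left.1 (hdisj k l hlk.symm) hkv hlv
    · rcases hother l hl with hlu | hlv
      · exact Set.disjoint_left.1 (hdisj k l hlk.symm) hku hlu
      · exact Set.disjoint_left.1 (hdisj j l hlj.symm) hjv hlv
    · exact Set.disjoint_left.1 (hdisj j k hjk) hjv hkv
  have key : ∀ i : Fin 4, ∃ j k l : Fin 4, j ≠ i ∧ k ≠ i ∧ j ≠ k ∧ l ≠ i ∧ l ≠ j ∧ l ≠ k := by decide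
  obtain ⟨j, k, l, hj, hk, hjk, hl, hlj, hlk⟩ := key i
  exact hcount j k hj hk hjk l hl hlj hlk

/-- **Stacking a vertex onto an edge does not create a `K₄` minor**: if every edge of `G'` outside `G` contains `x` (`x ≠ u, v`), every
`G'`-neighbour of `x` is `u` or `v`, and `u ~ v` in `G`, then a `K₄` minor of `G'` yields one of `G` (delete `x` from its branch set).
[cite: Diestel2017, §7.3 (Prop. 7.3.1)] -/
theorem hasK4Minor_of_stack {G G' : SimpleGraph V} {x u v : V} (hxu : x ≠ u) (hxv : x ≠ v)
    (hnew : ∀ a b, G'.Adj a b → ¬ G.Adj a b → a = x ∨ b = x) (hN : ∀ b, G'.Adj x b → b = u ∨ b = v) (huv : G.Adj u v)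
    (hK : HasK4Minor G') : HasK4Minor G := by
  classical
  obtain ⟨B, hne, hconn, hdisj, hadj⟩ := hK
  -- the companion of `x` in its branch set
  have hcomp : ∀ i, x ∈ B i → ∃ c ∈ B i, (c = u ∨ c = v) := by
    intro i hx
    rcases mem_or_mem_of_hasK4Minor_branch hN hconn hdisj hadj hx with h | h
    · exact ⟨u, h, Or.inl rfl⟩
    · exact ⟨v, h, Or.inr rfl⟩
  -- two distinct members of `{u, v}` are adjacent in `G`
  have hadjuv : ∀ c b : V, (c = u ∨ c = v) → (b = u ∨ b = v) → c ≠ b → G.Adj c b := by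
    rintro c b (rfl | rfl) (rfl | rfl) hcb
    · exact (hcb rfl).elim
    · exact huv
    · exact huv.symm
    · exact (hcb rfl).elim
  let B' : Fin 4 → Set V := fun i => B i \ {x}
  have hB'sub : ∀ i, B' i ⊆ B i := fun i _ h => h.1
  have hmemB' : ∀ i y, y ∈ B i → y ≠ x → y ∈ B' i := fun i y hy hyx => ⟨hy, hyx⟩
  refine ⟨B', fun i => ?_, fun i => ?_, fun i j hij => ?_, fun i j hij => ?_⟩
  · -- nonempty
    by_cases hx : x ∈ B i
    · obtain ⟨c, hc, hcuv⟩ := hcomp i hx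
      have hcx : c ≠ x := by rcases hcuv with rfl | rfl <;> [exact hxu.symm; exact hxv.symm]
      exact ⟨c, hmemB' i c hc hcx⟩
    · obtain ⟨a, ha⟩ := hne i
      exact ⟨a, hmemB' i a ha (fun h => hx (h ▸ ha))⟩
  · -- connected: map `x` to its companion, everything else to itself
    rw [SimpleGraph.connected_iff_exists_forall_reachable]
    by_cases hx : x ∈ B i
    · obtain ⟨c, hc, hcuv⟩ := hcomp i hx
      have hcx : c ≠ x := by rcases hcuv with rfl | rfl <;> [exact hxu.symm; exact hxv.symm]
      let φ : B i → B' i := fun a => if h : (a : V) = x then ⟨c, hmemB' i c hc hcx⟩ else ⟨a, hmemB' i a a.2 h⟩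
      have hφ : ∀ a b : B i, (G'.induce (B i)).Adj a b → (G.induce (B' i)).Reachable (φ a) (φ b) := by
        rintro ⟨a, ha⟩ ⟨b, hb⟩ h'
        rw [SimpleGraph.induce_adj] at h'
        by_cases hax : a = x <;> by_cases hbx : b = x
        · subst hax; subst hbx; exact (h'.ne rfl).elim
        · subst hax
          have hb' := hN b h'
          simp only [φ, dif_pos rfl, dif_neg hbx]
          by_cases hcb : c = b
          · subst hcb; exact SimpleGraph.Reachable.refl _
          · exact SimpleGraph.Adj.reachable (SimpleGraph.induce_adj.2 (hadjuv c b hcuv hb' hcb))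
        · subst hbx
          have ha' := hN a h'.symm
          simp only [φ, dif_pos rfl, dif_neg hax]
          by_cases hca : a = c
          · subst hca; exact SimpleGraph.Reachable.refl _
          · exact SimpleGraph.Adj.reachable (SimpleGraph.induce_adj.2 (hadjuv a c ha' hcuv hca))
        · simp only [φ, dif_neg hax, dif_neg hbx]
          have hG : G.Adj a b := by
            by_contra hn
            rcases hnew a b h' hn with h1 | h1
            · exact hax h1
            · exact hbx h1
          exact SimpleGraph.Adj.reachable (SimpleGraph.induce_adj.2 hG)
      refine ⟨⟨c, hmemB' i c hc hcx⟩, ?_⟩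
      rintro ⟨y, hy⟩
      have hr := reachable_map_of_adj (H := G'.induce (B i)) (H' := G.induce (B' i)) φ hφ
        ((hconn i) ⟨c, hc⟩ ⟨y, hy.1⟩)
      have h1 : φ ⟨c, hc⟩ = ⟨c, hmemB' i c hc hcx⟩ := by simp only [φ, dif_neg hcx]
      have h2 : φ ⟨y, hy.1⟩ = ⟨y, hy⟩ := by simp only [φ, dif_neg (show y ≠ x from hy.2)]
      rw [h1, h2] at hr
      exact hr
    · -- `x ∉ B i`: the induced graphs agree
      obtain ⟨a, ha⟩ := hne i
      have hax : a ≠ x := fun h => hx (h ▸ ha)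
      let φ : B i → B' i := fun a => ⟨a, hmemB' i a a.2 (fun h => hx (h ▸ a.2))⟩
      have hφ : ∀ a b : B i, (G'.induce (B i)).Adj a b → (G.induce (B' i)).Reachable (φ a) (φ b) := by
        rintro ⟨a, ha⟩ ⟨b, hb⟩ h'
        rw [SimpleGraph.induce_adj] at h'
        have hG : G.Adj a b := by
          by_contra hn
          rcases hnew a b h' hn with h1 | h1
          · exact hx (h1 ▸ ha)
          · exact hx (h1 ▸ hb)
        exact SimpleGraph.Adj.reachable (SimpleGraph.induce_adj.2 hG)
      refine ⟨⟨a, hmemB' i a ha hax⟩, ?_⟩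
      rintro ⟨y, hy⟩
      exact reachable_map_of_adj (H := G'.induce (B i)) (H' := G.induce (B' i)) φ hφ ((hconn i) ⟨a, ha⟩ ⟨y, hy.1⟩)
  · -- disjoint
    exact Set.disjoint_of_subset (hB'sub i) (hB'sub j) (hdisj i j hij)
  · -- adjacent
    obtain ⟨a, ha, b, hb, hab⟩ := hadj i j hij
    by_cases hax : a = x
    · subst hax
      obtain ⟨c, hc, hcuv⟩ := hcomp i ha
      have hb' := hN b hab
      have hcb : c ≠ b := fun h => Set.disjoint_left.1 (hdisj i j hij) hc (h ▸ hb)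
      have hcx : c ≠ a := by rcases hcuv with rfl | rfl <;> [exact hxu.symm; exact hxv.symm]
      have hbx : b ≠ a := hab.ne.symm
      exact ⟨c, hmemB' i c hc hcx, b, hmemB' j b hb hbx, hadjuv c b hcuv hb' hcb⟩
    · by_cases hbx : b = x
      · subst hbx
        obtain ⟨c, hc, hcuv⟩ := hcomp j hb
        have ha' := hN a hab.symm
        have hca : a ≠ c := fun h => Set.disjoint_left.1 (hdisj i j hij) ha (h ▸ hc)
        have hcx : c ≠ b := by rcases hcuv with rfl | rfl <;> [exact hxu.symm; exact hxv.symm]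
        exact ⟨a, hmemB' i a ha hax, c, hmemB' j c hc hcx, hadjuv a c ha' hcuv hca⟩
      · have hG : G.Adj a b := by
          by_contra hn
          rcases hnew a b hab hn with h1 | h1
          · exact hax h1
          · exact hbx h1
        exact ⟨a, hmemB' i a ha hax, b, hmemB' j b hb hbx, hG⟩

/-! ### 2-trees have no `K₄` minor -/

/-- A single edge has no `K₄` minor. [folklore] -/
theorem not_hasK4Minor_fromEdgeSet_pair (u v : V) : ¬ HasK4Minor (SimpleGraph.fromEdgeSet {s(u, v)}) := by
  classical
  rintro ⟨B, hne, -, hdisj, hadj⟩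
  -- every branch set contains `u` or `v`
  have hmem : ∀ i, u ∈ B i ∨ v ∈ B i := by
    intro i
    obtain ⟨j, hji⟩ : ∃ j : Fin 4, j ≠ i := ⟨i + 1, by
      intro h; have := congrArg Fin.val h; simp [Fin.val_add] at this; omega⟩
    obtain ⟨a, ha, b, -, hab⟩ := hadj i j hji.symm
    rw [SimpleGraph.fromEdgeSet_adj, Set.mem_singleton_iff, Sym2.eq_iff] at hab
    rcases hab.1 with ⟨rfl, -⟩ | ⟨rfl, -⟩
    · exact Or.inl ha
    · exact Or.inr ha
  have key : ∃ j k l : Fin 4, j ≠ k ∧ j ≠ l ∧ k ≠ l := ⟨0, 1, 2, by decide, by decide, by decide⟩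
  obtain ⟨j, k, l, hjk, hjl, hkl⟩ := key
  rcases hmem j with hj | hj <;> rcases hmem k with hk | hk
  · exact Set.disjoint_left.1 (hdisj j k hjk) hj hk
  · rcases hmem l with hl | hl
    · exact Set.disjoint_left.1 (hdisj j l hjl) hj hl
    · exact Set.disjoint_left.1 (hdisj k l hkl) hk hl
  · rcases hmem l with hl | hl
    · exact Set.disjoint_left.1 (hdisj k l hkl) hk hl
    · exact Set.disjoint_left.1 (hdisj j l hjl) hj hl
  · exact Set.disjoint_left.1 (hdisj j k hjk) hj hk

/-- **The edge graph of a 2-tree has no `K₄` minor.** [cite: Diestel2017, §7.3 (Prop. 7.3.1)] [cite: Wagner2006, §5.3] -/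
theorem not_hasK4Minor_of_isTwoTree {T : Set (Sym2 V)} (hT : IsTwoTree T) : ¬ HasK4Minor (SimpleGraph.fromEdgeSet T) := by
  classical
  induction hT with
  | pair huv => exact not_hasK4Minor_fromEdgeSet_pair _ _
  | @cons T u v x hT' huvT hx ih =>
    intro hK
    apply ih
    have hux : x ≠ u := fun h => hx _ huvT (h ▸ Sym2.mem_mk_left _ _)
    have hvx : x ≠ v := fun h => hx _ huvT (h ▸ Sym2.mem_mk_right _ _)
    have huv : u ≠ v := fun h => FK.IsTwoTree.not_isDiag hT' huvT (Sym2.mk_isDiag_iff.2 h)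
    refine hasK4Minor_of_stack (G' := SimpleGraph.fromEdgeSet (T ∪ {s(u, x), s(x, v)})) hux hvx ?_ ?_ ?_ hK
    · intro a b hab hn
      rw [SimpleGraph.fromEdgeSet_adj] at hab hn
      have hne : a ≠ b := hab.2
      rcases hab.1 with h | h | h
      · exact (hn ⟨h, hne⟩).elim
      · rw [Sym2.eq_iff] at h
        rcases h with ⟨rfl, rfl⟩ | ⟨rfl, rfl⟩
        · exact Or.inr rfl
        · exact Or.inl rfl
      · rw [Set.mem_singleton_iff, Sym2.eq_iff] at h
        rcases h with ⟨rfl, rfl⟩ | ⟨rfl, rfl⟩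
        · exact Or.inl rfl
        · exact Or.inr rfl
    · intro b hb
      rw [SimpleGraph.fromEdgeSet_adj] at hb
      rcases hb.1 with h | h | h
      · exact (hx _ h (Sym2.mem_mk_left _ _)).elim
      · rw [Sym2.eq_iff] at h
        rcases h with ⟨h1, -⟩ | ⟨-, rfl⟩
        · exact (hux h1).elim
        · exact Or.inl rfl
      · rw [Set.mem_singleton_iff, Sym2.eq_iff] at h
        rcases h with ⟨-, rfl⟩ | ⟨h1, -⟩
        · exact Or.inr rfl
        · exact (hvx h1).elim
    · exact (SimpleGraph.fromEdgeSet_adj _).2 ⟨huvT, huv⟩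

/-! ### The characterisation -/

/-- **`K₄`-minor-free ⟺ partial 2-tree** (Dirac 1952 / Duffin 1965 / Wald–Colbourn 1983): a finite graph on at least two vertices
has no `K₄` minor iff its edges lie inside a 2-tree. [cite: Diestel2017, §7.3 (Prop. 7.3.1, Cor. 7.3.2)] [cite: Wagner2006, §5.3] -/
theorem not_hasK4Minor_iff_exists_isTwoTree [Fintype V] [DecidableEq V] (G : SimpleGraph V) (hV : 2 ≤ Fintype.card V) :
    ¬ HasK4Minor G ↔ ∃ T : Set (Sym2 V), IsTwoTree T ∧ ∀ a b, G.Adj a b → s(a, b) ∈ T := by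
  constructor
  · intro hK
    have hcard : (Finset.univ : Finset V).card = (Fintype.card V - 2) + 2 := by rw [Finset.card_univ]; omega
    obtain ⟨T, hT, hedges, -, -, -⟩ := exists_superset_of_not_hasK4Minor (V := V) IsTwoTree
      (fun u v huv => IsTwoTree.pair huv) (fun T u v x hT huv hx => IsTwoTree.cons hT huv hx)
      (Fintype.card V - 2) Finset.univ G hcard hK (fun a b _ => ⟨Finset.mem_univ a, Finset.mem_univ b⟩)
    exact ⟨T, hT, hedges⟩
  · rintro ⟨T, hT, hedges⟩ hK
    refine not_hasK4Minor_of_isTwoTree hT (hasK4Minor_of_le (fun a b hab => ?_) hK)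
    exact (SimpleGraph.fromEdgeSet_adj _).2 ⟨hedges a b hab, hab.ne⟩

end K4Free

end Summit.CriticalPhenomena.PercolationContinuityZ3.Theorems
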